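import Literature.AlgebraicGeometry.HodgeTheory.ComplexConjugationHolds
import Literature.AlgebraicGeometry.Motives.VarietiesUnitProofs
import Literature.AlgebraicGeometry.Motives.FermatHypersurface
import HarnessLib

/-!
# Where the carrier `HodgeModel n X` is inhabited and where it is empty

Family `hodge`, layer `Literature/AlgebraicGeometry/HodgeTheory`. Carrier-census companion
(D-0034, `docs/m5/CARRIER-CENSUS-2026-08-17.md`) of `RationalHodgeClasses`, which declares the
structure `HodgeTheory.HodgeModel n X` (a Hodge model of the `ℂ`-scheme `X` in dimension `n`:
a Hausdorff σ-compact complex manifold `A.carrier` charted on a complex model space `A.model`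
with `finrank ℂ A.model = n`, a homeomorphism `A.toComplexPoints : A.carrier → X(ℂ)` which is an
analytification of `X` (Serre, GAGA §2), a natural complex de Rham comparison family over the
manifolds charted on `A.model` (de Rham's theorem) and the Hodge decomposition of
`H^k_dR(A.carrier; ℂ)` into the spans of closed `(p,q)`-forms (Voisin I, Prop. 6.11)). 65 route
items of `HodgeConjecture` bind over this carrier; the census probe could neither inhabit nor
refute `∀ n X, Nonempty (HodgeModel n X)` (class `unknown`).

## Verdict: inhabited at some parameters, empty at others (the uniform statement is FALSE)

* **Inhabited region (all items live here).** For every smooth projective, geometrically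
  irreducible `X/ℂ` of dimension `n` (`Motives.IsSmoothProjective n X`) the type `HodgeModel n X`
  is inhabited: `HodgeModel_nonempty` — this is the tree's closed theorem
  `nonempty_hodgeModel_holds` (`ComplexConjugationHolds`: Serre's analytification `X^an`, compact
  and Hausdorff [cite: SerreGAGA1956, §2 n°5 Prop. 2 and n°7 Prop. 6]; de Rham's theorem
  [cite: WarnerGTM94, Thm. 5.36]; `X^an ⊂ ℙᴺ(ℂ)` is Kähler and the Hodge decomposition of compact
  Kähler manifolds [cite: VoisinHodgeI2002, §3.3.2 and §6.1.3 Prop. 6.11]), re-exported under the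
  census name, with registered instances at the specific parameters met in route items:
  `ℙⁿ_ℂ` (`HodgeModel.instNonemptyProjectiveSpace`), the point `𝟙_ (SchemeOver ℂ) = Spec ℂ` in
  dimension `0` (`HodgeModel.instNonemptyUnit`), and the Fermat hypersurfaces
  `V₊(x₀ᵐ + ⋯ + x_{n+1}ᵐ) ⊂ ℙⁿ⁺¹_ℂ`, `n, m ≥ 1` (`HodgeModel.instNonemptyFermat`, covering the
  binder `HodgeModel (2 * 2) (hypersurface (fermatPolynomial ℂ (2 * 2) m))` of
  `DerivedTorelliFermat.EigenspaceInputs`).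
* **Empty regions (findings; no route item binds here).** A Hodge model transports the local
  topology of the model space `A.model ≅ ℂⁿ` to `X(ℂ)` through the charts and the homeomorphism
  `A.toComplexPoints`:
  - if `n ≠ 0`, then `X(ℂ)` has no isolated point (`HodgeModel.not_isOpen_singleton`: a singleton
    open in `X(ℂ)` would give a singleton open in the nontrivial normed space `A.model`); hence
    `HodgeModel n X` is EMPTY whenever `n ≠ 0` and `X(ℂ)` has an isolated point
    (`HodgeModel_isEmpty_of_isOpen_singleton`), e.g. for every `X` with `X(ℂ)` discrete and
    non-empty — the point: `IsEmpty (HodgeModel (n + 1) (𝟙_ (SchemeOver ℂ)))`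
    (`HodgeModel_isEmpty_unit_succ`), and every smooth projective `X` of dimension `0`
    (`HodgeModel_isEmpty_succ_of_isSmoothProjective_zero`);
  - if `n = 0`, then `A.model = 0`, every chart source is a singleton, and `X(ℂ)` is discrete
    (`HodgeModel.discreteTopology`); hence `HodgeModel 0 X` is EMPTY whenever `X(ℂ)` is not
    discrete (`HodgeModel_isEmpty_zero_of_not_discreteTopology`), e.g. for every smooth projective
    `X` of positive dimension (`HodgeModel_isEmpty_zero_of_isSmoothProjective_succ`), concretely
    `IsEmpty (HodgeModel 0 (projectiveSpace (d + 1) ℂ))` (`HodgeModel_isEmpty_zero_projectiveSpace`);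
  - `X(ℂ)` not Hausdorff ⟹ empty for every `n` (`HodgeModel_isEmpty_of_not_t2Space`, via
    `HodgeModel.t2Space_complexPoints`: the carrier is Hausdorff by the field `t2Space`).
  Consequently `not_forall_nonempty_hodgeModel : ¬ ∀ n X, Nonempty (HodgeModel n X)`, and the two
  existential census views `exists_nonempty_hodgeModel`, `exists_isEmpty_hodgeModel` both hold.
* **Not decided here (honest boundary).** For `X` smooth projective of dimension `d` and
  `0 < n ≠ d > 0` the type `HodgeModel n X` is empty by invariance of dimension (`X(ℂ)` is a
  topological `2d`-manifold), which Mathlib does not have; only the partial rigidity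
  `HodgeModel.eq_zero_iff_eq_zero` (`n = 0 ↔ d = 0` for two Hodge models of the same `X` with
  `X(ℂ) ≠ ∅`) is proved. For non-proper smooth `X` the answer depends on Hodge theory of the open
  manifold `X(ℂ)` (e.g. `𝔾_m`: `H¹_dR(ℂˣ) = ℂ·[dz/z] = ℂ·[dz̄/z̄]`, so the `(1,0)` and `(0,1)` spans
  are not independent and `HodgeModel 1 𝔾_m = ∅`; `𝔸ⁿ`: inhabited) and is not formalised; no
  route item binds over such parameters: the 65 items bind `HodgeModel n X` under
  `IsSmoothProjective n X` with the binder's `n` (directly or through `IsSmoothHypersurface n m X`,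
  or as `IsSmoothProjective 2 (fiberOver f s)` for fibres), or at a specific smooth projective
  variety of the binder's dimension (Fermat hypersurfaces `HodgeModel (2 * p) (hypersurface
  (fermatPolynomial ℂ (2 * p) m))`), all inside the inhabited region.

No definition, no named fact (D-0026): theorems and `Nonempty` instances only.

## References

* J.-P. Serre, *Géométrie algébrique et géométrie analytique*, Ann. Inst. Fourier 6 (1956), §2
  n°5 Prop. 2, n°7 Prop. 6. [SerreGAGA1956]
* C. Voisin, *Hodge Theory and Complex Algebraic Geometry I* (2002), §3.3.2, §6.1.3 Prop. 6.11.
  [VoisinHodgeI2002]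
* F. W. Warner, *Foundations of Differentiable Manifolds and Lie Groups*, GTM 94 (1983),
  Thm. 5.36. [WarnerGTM94]
* R. Hartshorne, *Algebraic Geometry* (1977), I Ex. 5.5, II Example 8.20.2 (Fermat
  hypersurfaces are nonsingular), II.4 and III.10.1 (`ℙⁿ`, `Spec k`). [Hartshorne1977]
-/

noncomputable section

open scoped Manifold ContDiff Topology
open CategoryTheory MonoidalCategory

namespace Literature.AlgebraicGeometry.HodgeTheory

section HodgeTheory

variable {n d : ℕ} {X : Motives.SchemeOver ℂ}

/-! ### The inhabited region: smooth projective `X` of dimension `n` -/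

/-- **Carrier witness for `HodgeModel` (census name).** Every smooth projective, geometrically
irreducible `X/ℂ` of dimension `n` has a Hodge model: Serre's analytification `X^an → X(ℂ)`
(a compact Hausdorff complex manifold charted on `ℂⁿ`), de Rham's comparison, and the Hodge
decomposition of the compact Kähler manifold `X^an ⊂ ℙᴺ(ℂ)`. This is the tree's closed theorem
`nonempty_hodgeModel_holds` (trust base: nothing unproved). The hypothesis cannot be dropped:
see `not_forall_nonempty_hodgeModel`. [cite: SerreGAGA1956, §2 n°5 Prop. 2 and n°7 Prop. 6]
[cite: VoisinHodgeI2002, §3.3.2 and §6.1.3 Prop. 6.11] -/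
theorem HodgeModel_nonempty (hX : Motives.IsSmoothProjective n X) : Nonempty (HodgeModel n X) :=
  nonempty_hodgeModel_holds hX

/-- A smooth hypersurface `X = V₊(F) ⊂ ℙⁿ⁺¹_ℂ` of dimension `n` (`Motives.IsSmoothHypersurface n m X`,
whose first conjunct is `IsSmoothProjective n X`) has a Hodge model in dimension `n` — the shape of
the hypersurface items (`… IsSmoothHypersurface 8 3 Y → Nonempty (HodgeModel 8 Y)`).
[cite: SerreGAGA1956, §2 n°5 Prop. 2 and n°7 Prop. 6] [cite: VoisinHodgeI2002, §6.1.3 Prop. 6.11] -/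
theorem HodgeModel_nonempty_of_isSmoothHypersurface {m : ℕ} (hX : Motives.IsSmoothHypersurface n m X) :
    Nonempty (HodgeModel n X) :=
  HodgeModel_nonempty hX.1

/-- Projective space `ℙⁿ_ℂ` has a Hodge model in dimension `n` (`ℙⁿ` is smooth projective of
dimension `n`, `Motives.isSmoothProjective_projectiveSpace_holds`).
[cite: Hartshorne1977, II.4.8 and III.10.1] [cite: VoisinHodgeI2002, §6.1.3 Prop. 6.11] -/
instance HodgeModel.instNonemptyProjectiveSpace (n : ℕ) :
    Nonempty (HodgeModel n (Motives.projectiveSpace n ℂ)) :=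
  HodgeModel_nonempty (Motives.isSmoothProjective_projectiveSpace_holds ℂ n)

/-- The point `Spec ℂ = 𝟙_ (SchemeOver ℂ)` has a Hodge model in dimension `0` (it is smooth
projective of dimension `0`, `Motives.isSmoothProjective_unit_holds`).
[cite: Hartshorne1977, II.4] [cite: VoisinHodgeI2002, §6.1.3 Prop. 6.11] -/
instance HodgeModel.instNonemptyUnit : Nonempty (HodgeModel 0 (𝟙_ (Motives.SchemeOver ℂ))) :=
  HodgeModel_nonempty (Motives.isSmoothProjective_unit_holds ℂ)

/-- The Fermat hypersurface `V₊(x₀ᵐ + ⋯ + x_{n+1}ᵐ) ⊂ ℙⁿ⁺¹_ℂ` (`n, m ≥ 1`) has a Hodge model in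
dimension `n` (it is smooth projective of dimension `n`,
`Motives.SmoothHypersurface.isSmoothProjective_hypersurface_fermatPolynomial_of_charZero`).
[cite: Hartshorne1977, I Ex. 5.5 and II Example 8.20.2] [cite: VoisinHodgeI2002, §6.1.3 Prop. 6.11] -/
theorem HodgeModel_nonempty_fermat {m : ℕ} (hn : 1 ≤ n) (hm : 1 ≤ m) :
    Nonempty (HodgeModel n
      (Motives.SmoothHypersurface.hypersurface (Motives.fermatPolynomial ℂ n m))) :=
  HodgeModel_nonempty
    (Motives.SmoothHypersurface.isSmoothProjective_hypersurface_fermatPolynomial_of_charZero hn hm)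

/-- Instance form of `HodgeModel_nonempty_fermat`, found by instance search at numeral parameters
such as the Fermat fourfold `HodgeModel (2 * 2) (hypersurface (fermatPolynomial ℂ (2 * 2) m))`,
`[NeZero m]`. [cite: Hartshorne1977, I Ex. 5.5 and II Example 8.20.2] -/
instance HodgeModel.instNonemptyFermat (n m : ℕ) [NeZero n] [NeZero m] :
    Nonempty (HodgeModel n
      (Motives.SmoothHypersurface.hypersurface (Motives.fermatPolynomial ℂ n m))) :=
  HodgeModel_nonempty_fermat NeZero.one_le NeZero.one_le

/-! ### What a Hodge model imposes on the topology of `X(ℂ)` -/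

namespace HodgeModel

/-- The model space of a Hodge model in dimension `n ≠ 0` is a nontrivial vector space
(`finrank ℂ A.model = n`). [cite: SerreGAGA1956, §2 n°5 Prop. 2] -/
theorem nontrivial_model (A : HodgeModel n X) (hn : n ≠ 0) : Nontrivial A.model :=
  Module.nontrivial_of_finrank_pos (R := ℂ)
    (by rw [A.isAnalytification.finrank_eq]; exact Nat.pos_of_ne_zero hn)

/-- In dimension `n ≠ 0` no point of the carrier `X^an` is isolated: the chart at `x` would map
the open singleton `{x}` onto an open singleton of the nontrivial normed space `A.model ≅ ℂⁿ`,
where punctured neighbourhoods are non-trivial. [cite: SerreGAGA1956, §2 n°5 Prop. 2] -/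
theorem not_isOpen_singleton_carrier (A : HodgeModel n X) (hn : n ≠ 0) (x : A.carrier) :
    ¬ IsOpen ({x} : Set A.carrier) := by
  intro hx
  haveI : Nontrivial A.model := A.nontrivial_model hn
  have himg : IsOpen (chartAt A.model x '' {x}) :=
    (chartAt A.model x).isOpen_image_of_subset_source hx
      (Set.singleton_subset_iff.2 (mem_chart_source A.model x))
  rw [Set.image_singleton] at himg
  have hbot : (𝓝[≠] (chartAt A.model x x)).NeBot := inferInstance
  exact hbot.ne ((isOpen_singleton_iff_punctured_nhds _).1 himg)

/-- In dimension `n ≠ 0` no complex point of `X` is isolated in `X(ℂ)` (transport along the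
homeomorphism `A.toComplexPoints : X^an → X(ℂ)`). [cite: SerreGAGA1956, §2 n°5 Prop. 2] -/
theorem not_isOpen_singleton (A : HodgeModel n X) (hn : n ≠ 0) (P : Motives.ComplexPoints X) :
    ¬ IsOpen ({P} : Set (Motives.ComplexPoints X)) := by
  intro hP
  obtain ⟨x, rfl⟩ := A.isAnalytification.isHomeomorph.surjective P
  refine A.not_isOpen_singleton_carrier hn x ?_
  have h := hP.preimage A.isAnalytification.isHomeomorph.continuous
  rwa [← Set.image_singleton,
    Set.preimage_image_eq _ A.isAnalytification.isHomeomorph.injective] at h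

/-- The model space of a Hodge model in dimension `0` is the zero space.
[cite: SerreGAGA1956, §2 n°5 Prop. 2] -/
theorem subsingleton_model (A : HodgeModel 0 X) : Subsingleton A.model :=
  Module.finrank_zero_iff.1 A.isAnalytification.finrank_eq

/-- In dimension `0` the carrier `X^an` is discrete: the chart at `x` is injective on its open
source with values in the one-point space `A.model = 0`, so its source is `{x}`.
[cite: SerreGAGA1956, §2 n°5 Prop. 2] -/
theorem discreteTopology_carrier (A : HodgeModel 0 X) : DiscreteTopology A.carrier := by
  haveI : Subsingleton A.model := A.subsingleton_model
  refine discreteTopology_iff_isOpen_singleton.2 fun x ↦ ?_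
  have hsrc : (chartAt A.model x).source = {x} := by
    refine Set.eq_singleton_iff_unique_mem.2 ⟨mem_chart_source A.model x, fun y hy ↦ ?_⟩
    exact (chartAt A.model x).injOn hy (mem_chart_source A.model x) (Subsingleton.elim _ _)
  rw [← hsrc]
  exact (chartAt A.model x).open_source

/-- In dimension `0` the space of complex points `X(ℂ)` is discrete (transport along the
homeomorphism `A.toComplexPoints`). [cite: SerreGAGA1956, §2 n°5 Prop. 2] -/
protected theorem discreteTopology (A : HodgeModel 0 X) :
    DiscreteTopology (Motives.ComplexPoints X) := by
  haveI : DiscreteTopology A.carrier := A.discreteTopology_carrier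
  exact DiscreteTopology.of_continuous_injective
    A.isAnalytification.homeomorph.symm.continuous A.isAnalytification.homeomorph.symm.injective

/-- `X(ℂ)` is Hausdorff as soon as `X` has a Hodge model (the carrier is Hausdorff, field
`t2Space`, and homeomorphic to `X(ℂ)`). [cite: SGA1, Exp. XII Prop. 3.1] -/
theorem t2Space_complexPoints (A : HodgeModel n X) : T2Space (Motives.ComplexPoints X) :=
  A.isAnalytification.homeomorph.t2Space

/-- **Partial dimension rigidity.** Two Hodge models `A : HodgeModel n X`, `B : HodgeModel d X`
of the same `X` with `X(ℂ) ≠ ∅` are both of dimension `0` or both of positive dimension: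
dimension `0` makes `X(ℂ)` discrete, positive dimension forbids isolated points. (Full
rigidity `n = d` is invariance of dimension for the topological manifold `X(ℂ)`, not available
in Mathlib.) [cite: SerreGAGA1956, §2 n°5 Prop. 2] -/
theorem eq_zero_iff_eq_zero [h : Nonempty (Motives.ComplexPoints X)] (A : HodgeModel n X)
    (B : HodgeModel d X) : n = 0 ↔ d = 0 := by
  have key : ∀ {a b : ℕ}, HodgeModel a X → HodgeModel b X → a = 0 → b = 0 := by
    intro a b A' B' ha
    subst ha
    by_contra hb
    haveI : DiscreteTopology (Motives.ComplexPoints X) := A'.discreteTopology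
    obtain ⟨P⟩ := h
    exact B'.not_isOpen_singleton hb P (isOpen_discrete _)
  exact ⟨key A B, key B A⟩

end HodgeModel

/-! ### The empty regions -/

/-- **Empty region I: positive dimension over an isolated point.** If `n ≠ 0` and some complex
point `P` of `X` is isolated in `X(ℂ)`, then `X` has NO Hodge model in dimension `n`
(every item quantifying over `HodgeModel n X` is vacuous at such parameters).
[cite: SerreGAGA1956, §2 n°5 Prop. 2] -/
theorem HodgeModel_isEmpty_of_isOpen_singleton (hn : n ≠ 0) {P : Motives.ComplexPoints X}
    (hP : IsOpen ({P} : Set (Motives.ComplexPoints X))) : IsEmpty (HodgeModel n X) :=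
  ⟨fun A ↦ A.not_isOpen_singleton hn P hP⟩

/-- Empty region I, discrete form: `n ≠ 0` and `X(ℂ)` discrete and non-empty (e.g. `X` a
non-empty zero-dimensional variety) ⟹ `HodgeModel n X` is empty. [cite: SerreGAGA1956, §2 n°5 Prop. 2] -/
theorem HodgeModel_isEmpty_of_discreteTopology (hn : n ≠ 0)
    [DiscreteTopology (Motives.ComplexPoints X)] [h : Nonempty (Motives.ComplexPoints X)] :
    IsEmpty (HodgeModel n X) :=
  h.elim fun P ↦ HodgeModel_isEmpty_of_isOpen_singleton hn (P := P) (isOpen_discrete _)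

/-- **Empty region II: dimension `0` over a non-discrete `X(ℂ)`.** If `X(ℂ)` is not discrete
(e.g. `X` a variety of positive dimension), then `X` has NO Hodge model in dimension `0`.
[cite: SerreGAGA1956, §2 n°5 Prop. 2] -/
theorem HodgeModel_isEmpty_zero_of_not_discreteTopology
    (h : ¬ DiscreteTopology (Motives.ComplexPoints X)) : IsEmpty (HodgeModel 0 X) :=
  ⟨fun A ↦ h A.discreteTopology⟩

/-- **Empty region III: non-Hausdorff complex points.** If `X(ℂ)` is not Hausdorff (e.g. `X` not
separated: the line with a doubled origin), then `X` has no Hodge model in any dimension.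
[cite: SGA1, Exp. XII Prop. 3.1] -/
theorem HodgeModel_isEmpty_of_not_t2Space (h : ¬ T2Space (Motives.ComplexPoints X)) :
    IsEmpty (HodgeModel n X) :=
  ⟨fun A ↦ h A.t2Space_complexPoints⟩

/-- A smooth projective `X` of positive dimension `d + 1` with a complex point has no Hodge model
in dimension `0` (it has one in dimension `d + 1`, and `HodgeModel.eq_zero_iff_eq_zero`).
[cite: SerreGAGA1956, §2 n°5 Prop. 2] [cite: VoisinHodgeI2002, §6.1.3 Prop. 6.11] -/
theorem HodgeModel_isEmpty_zero_of_isSmoothProjective_succ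
    (hX : Motives.IsSmoothProjective (d + 1) X) [Nonempty (Motives.ComplexPoints X)] :
    IsEmpty (HodgeModel 0 X) := by
  obtain ⟨B⟩ := HodgeModel_nonempty hX
  exact ⟨fun A ↦ Nat.succ_ne_zero d ((A.eq_zero_iff_eq_zero B).1 rfl)⟩

/-- A smooth projective `X` of dimension `0` with a complex point has no Hodge model in any
positive dimension `n + 1`. [cite: SerreGAGA1956, §2 n°5 Prop. 2]
[cite: VoisinHodgeI2002, §6.1.3 Prop. 6.11] -/
theorem HodgeModel_isEmpty_succ_of_isSmoothProjective_zero
    (hX : Motives.IsSmoothProjective 0 X) [Nonempty (Motives.ComplexPoints X)] :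
    IsEmpty (HodgeModel (n + 1) X) := by
  obtain ⟨B⟩ := HodgeModel_nonempty hX
  exact ⟨fun A ↦ Nat.succ_ne_zero n ((B.eq_zero_iff_eq_zero A).1 rfl)⟩

/-- **The point in positive dimension: `HodgeModel (n + 1) (Spec ℂ) = ∅`.** The complex points of
the point `𝟙_ (SchemeOver ℂ)` form a one-point space (a terminal object has a unique point), whose
point is isolated. [cite: SerreGAGA1956, §2 n°5 Prop. 2] -/
theorem HodgeModel_isEmpty_unit_succ (n : ℕ) :
    IsEmpty (HodgeModel (n + 1) (𝟙_ (Motives.SchemeOver ℂ))) := by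
  refine HodgeModel_isEmpty_of_isOpen_singleton (Nat.succ_ne_zero n)
    (P := CartesianMonoidalCategory.toUnit _) ?_
  rw [show ({CartesianMonoidalCategory.toUnit _} : Set (Motives.ComplexPoints (𝟙_ (Motives.SchemeOver ℂ))))
      = Set.univ from Set.eq_univ_of_forall fun Q ↦ Subsingleton.elim _ _]
  exact isOpen_univ

/-- **Projective space of positive dimension in dimension `0`: `HodgeModel 0 ℙᵈ⁺¹_ℂ = ∅`**
(`ℙᵈ⁺¹` is smooth projective of dimension `d + 1` and has the complex point `[1 : ⋯ : 1]`,
`Literature.NumberTheory.Transcendental.pointOfVec`). [cite: SerreGAGA1956, §2 n°5 Prop. 2]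
[cite: Hartshorne1977, II.4.8 and III.10.1] -/
theorem HodgeModel_isEmpty_zero_projectiveSpace (d : ℕ) :
    IsEmpty (HodgeModel 0 (Motives.projectiveSpace (d + 1) ℂ)) := by
  haveI : Nonempty (Motives.ComplexPoints (Motives.projectiveSpace (d + 1) ℂ)) :=
    ⟨Literature.NumberTheory.Transcendental.pointOfVec (d + 1) (fun _ ↦ 1)
      (Function.ne_iff.2 ⟨0, one_ne_zero⟩)⟩
  exact HodgeModel_isEmpty_zero_of_isSmoothProjective_succ
    (Motives.isSmoothProjective_projectiveSpace_holds ℂ (d + 1))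

/-! ### The census views -/

/-- **The uniform carrier statement is false**: it fails at `(n, X) = (1, Spec ℂ)`
(`HodgeModel_isEmpty_unit_succ`). The 65 route items binding over `HodgeModel n X` do so under
`Motives.IsSmoothProjective n X` with the binder's `n` (or at a specific smooth projective `X` of
the binder's dimension), where `HodgeModel_nonempty` applies. [cite: SerreGAGA1956, §2 n°5 Prop. 2] -/
theorem not_forall_nonempty_hodgeModel :
    ¬ ∀ (n : ℕ) (X : Motives.SchemeOver ℂ), Nonempty (HodgeModel n X) :=
  fun h ↦ (HodgeModel_isEmpty_unit_succ 0).false (h 1 (𝟙_ (Motives.SchemeOver ℂ))).some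

/-- Existential census view, inhabited side: some `HodgeModel n X` is inhabited (`n = 0`,
`X = Spec ℂ`; also every `ℙⁿ`). [cite: VoisinHodgeI2002, §6.1.3 Prop. 6.11] -/
theorem exists_nonempty_hodgeModel :
    ∃ (n : ℕ) (X : Motives.SchemeOver ℂ), Nonempty (HodgeModel n X) :=
  ⟨0, 𝟙_ (Motives.SchemeOver ℂ), HodgeModel.instNonemptyUnit⟩

/-- Existential census view, empty side: some `HodgeModel n X` is empty (`n = 1`, `X = Spec ℂ`).
[cite: SerreGAGA1956, §2 n°5 Prop. 2] -/
theorem exists_isEmpty_hodgeModel :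
    ∃ (n : ℕ) (X : Motives.SchemeOver ℂ), IsEmpty (HodgeModel n X) :=
  ⟨1, 𝟙_ (Motives.SchemeOver ℂ), HodgeModel_isEmpty_unit_succ 0⟩

/-- At the fixed scheme `X = Spec ℂ` the carrier is inhabited exactly in dimension `0`.
[cite: SerreGAGA1956, §2 n°5 Prop. 2] [cite: Hartshorne1977, II.4] -/
theorem nonempty_hodgeModel_unit_iff (n : ℕ) :
    Nonempty (HodgeModel n (𝟙_ (Motives.SchemeOver ℂ))) ↔ n = 0 := by
  refine ⟨fun h ↦ ?_, ?_⟩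
  · cases n with
    | zero => rfl
    | succ n => exact ((HodgeModel_isEmpty_unit_succ n).false h.some).elim
  · rintro rfl
    exact HodgeModel.instNonemptyUnit

end HodgeTheory

end Literature.AlgebraicGeometry.HodgeTheory

end
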